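import Mathlib
import Literature.Computability.AlgebraicComplexity.LRPencilOfMatrix
import Summits.ValiantsHypothesis.ValiantsHypothesis.Theorems.GrenetZeonTwoDimCoefficientsDefs
import Summits.ValiantsHypothesis.ValiantsHypothesis.Theorems.GrenetZeonTwoDimCoefficientsDualUnipotentTriangular

/-!
# Time-UNFOLDING of a block-triangular nilpotent pencil — CORE (sigma state space, selector matrices, the trace identity)

Part 1 of 2 (split at the 400-line lint; part 2 = `…DualUnipotentUnfolding`: reindexing to `Fin`, the index-mass rungs).

# Time-UNFOLDING of a block-triangular nilpotent pencil: the triangularisable rung reaches every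
  pencil whose diagonal constituents have bounded nil-index (PORTRAIT half U of the wild obstruction)

Crux `GrenetZeon.TwoDimCoefficients` (stmt-ValiantsHypothesis-8062) / rung `GrenetZeon.DualUnipotentThreeHalves`
(stmt-ValiantsHypothesis-24318), stub `stub_dualUnipotent`.  The located open point of the triangularisable rung
`sq_le_of_trace_pow_mul_strictUpper'` (this directory, `…DualUnipotentTriangular`) is the WILD (not simultaneously
triangularisable) nilpotent pencil.  This file PRICES wildness by nil-index.

**Setting.**  `N, M` affine `m × m` pencils over `ℂ[x_ij]`, `lev : Fin m → ℕ` a level function with `N`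
block-upper-triangular for it (`N i j = 0` if `lev j < lev i`; e.g. the levels of any chain of subspaces invariant under
the whole pencil space), and `r : ℕ → ℕ` with `(diagBlock N lev l)^(r l) = 0` for every level `l` (the generic element
of the `l`-th diagonal constituent is nilpotent of index `≤ r l`; wild irreducible constituents have `r l ≥ 3`).

**Theorem U1 (`exists_strictUpper_unfolding`).**  There are affine `N', M'` of size `Σ_u r (lev u)` (the INDEX MASS)
with `N'` STRICTLY upper triangular and `tr(N'^d M') = tr(N^d M)` (every `d`).  Construction: states `(u, c)`,
`c < r (lev u)` («time since entering the level»); `N'` sends `(u,c) → (v,c+1)` with the same-level part of `N` and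
`(u,c) → (v,0)` with the strictly-upper part; `M'` reads copy `0`; a run of `≥ r l` consecutive steps inside level `l`
is a power `≥ r l` of ONE matrix `diagBlock N lev l`, hence contributes `0` — exactly the step where a flag argument
fails for wild blocks.  Kernel route: the invariant `esel c · unfN^d · fsel = psel (c+d)·D^d + Σ_{j<d} psel (c+j)·D^j·U·N^{d−1−j}`
(`Unfold.esel_pow_fsel`), `Matrix.trace_mul_comm`, and an order-preserving enumeration of the states.

**Corollaries (the portrait inequality, citable).**  If moreover `per_n = tr(N^d M)`, then for every `q ≥ 1`
`q·n² ≤ 2n(I + q) + I·q²` with `I = Σ_u r (lev u)` (`sq_le_indexMass_of_blockNilpotent`), and for `n ≥ 4`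
`n³ ≤ 144·I²` (`cube_le_indexMass_sq_of_blockNilpotent`): EVERY block form of EVERY unipotent-dual / trace-of-power
representation of `per_n` has index mass `≥ n^{3/2}/12`.  For a triangularisable pencil (`lev = id`, `r ≡ 1`) this is
the landed rung with `I = m`; a counterexample to the `n^{3/2}` rung must therefore consist, in every block form, of wild
constituents of large nil-index AND size (val-idea-9 line «wild_unfold», critic val-idea-crit-3 VERDICT #2 P2).

HONEST FRAMING: per-agnostic matrix algebra + the landed rung; it proves NOTHING about which block forms `per_n`
admits (that is the open, per-specific crux `CheapIndexMass` of the line); `stub_dualUnipotent`, the 3/2 rung, the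
crux 8062 and `VP ≠ VNP` are not moved.  Authored by val-idea-9 g0 (planner seat; Theorems landing by turnkey).
-/


set_option linter.dupNamespace false
set_option autoImplicit false

noncomputable section

namespace Summit.ValiantsHypothesis.ValiantsHypothesis.Cruxes.TwoDimCoefficients.DimTwoCases

open MvPolynomial Matrix
open scoped BigOperators
open Literature.Computability.AlgebraicComplexity

/-- The `l`-th diagonal block of `N` for the level function `lev` (zero outside the block). -/
def diagBlock {n m : ℕ} (N : AffMat n m) (lev : Fin m → ℕ) (l : ℕ) : AffMat n m :=
  fun i j => if lev i = l ∧ lev j = l then N i j else 0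

namespace Unfold


variable {n m : ℕ}

/-- States of the unfolding: `(u, c)` with `c < r (lev u)`. -/
abbrev St (lev : Fin m → ℕ) (r : ℕ → ℕ) : Type := Σ u : Fin m, Fin (r (lev u))

section Defs
variable (lev : Fin m → ℕ) (r : ℕ → ℕ)

/-- block-diagonal part -/
def dgPart (N : AffMat n m) : AffMat n m :=
  fun u w => if lev u = lev w then N u w else 0
/-- strictly block-upper part -/
def upPart (N : AffMat n m) : AffMat n m :=
  fun u w => if lev u < lev w then N u w else 0
/-- the unfolded pencil -/
def unfN (N : AffMat n m) : Matrix (St lev r) (St lev r) (MvPolynomial (Fin n × Fin n) ℂ) := fun s t =>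
  if (lev s.1 = lev t.1 ∧ (t.2 : ℕ) = (s.2 : ℕ) + 1) ∨ (lev s.1 < lev t.1 ∧ (t.2 : ℕ) = 0) then N s.1 t.1 else 0
/-- the unfolded read-out matrix -/
def unfM (M : AffMat n m) : Matrix (St lev r) (St lev r) (MvPolynomial (Fin n × Fin n) ℂ) := fun t s =>
  if (s.2 : ℕ) = 0 then M t.1 s.1 else 0
variable (n) in
/-- selector of copy `c` -/
def esel (c : ℕ) : Matrix (Fin m) (St lev r) (MvPolynomial (Fin n × Fin n) ℂ) :=
  fun u t => if t.1 = u ∧ (t.2 : ℕ) = c then 1 else 0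
variable (n) in
/-- forget the copy index -/
def fsel : Matrix (St lev r) (Fin m) (MvPolynomial (Fin n × Fin n) ℂ) := fun t u => if t.1 = u then 1 else 0
variable (n) in
/-- rows with at least `c + 1` copies -/
def psel (c : ℕ) : AffMat n m :=
  Matrix.diagonal fun u => if c < r (lev u) then 1 else 0

end Defs

variable {lev : Fin m → ℕ} {r : ℕ → ℕ}

/-- Helper `sum_St_ite` of the unfolding core (val-idea-9 turnkey; docstring added at filing). [folklore] -/
theorem sum_St_ite (u : Fin m) (c : ℕ) (f : St lev r → MvPolynomial (Fin n × Fin n) ℂ) :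
    (∑ t : St lev r, if t.1 = u ∧ (t.2 : ℕ) = c then f t else 0) =
      if h : c < r (lev u) then f ⟨u, ⟨c, h⟩⟩ else 0 := by
  classical
  split_ifs with h
  · rw [Finset.sum_eq_single ⟨u, ⟨c, h⟩⟩]
    · simp
    · rintro ⟨t1, t2⟩ - ht
      rw [if_neg]
      rintro ⟨h1, h2⟩
      apply ht
      simp only at h1 h2
      subst h1
      simp [Fin.ext_iff, h2]
    · intro h'; exact absurd (Finset.mem_univ _) h'
  · refine Finset.sum_eq_zero fun t _ => ?_
    rw [if_neg]
    rintro ⟨h1, h2⟩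
    exact h (h2 ▸ h1 ▸ t.2.isLt)

/-- Helper `sum_fin_ite` of the unfolding core (val-idea-9 turnkey; docstring added at filing). [folklore] -/
theorem sum_fin_ite (w₀ : Fin m) (P : Prop) [Decidable P] (f : Fin m → MvPolynomial (Fin n × Fin n) ℂ) :
    (∑ w : Fin m, if w₀ = w ∧ P then f w else 0) = if P then f w₀ else 0 := by
  classical
  by_cases hP : P
  · simp only [hP, and_true, if_true]
    rw [Finset.sum_ite_eq]; simp
  · simp [hP]

/-- Helper `esel_mul_unfN` of the unfolding core (val-idea-9 turnkey; docstring added at filing). [folklore] -/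
theorem esel_mul_unfN (N : AffMat n m) (c : ℕ) :
    esel n lev r c * unfN lev r N = psel n lev r c * (dgPart lev N * esel n lev r (c + 1) + upPart lev N * esel n lev r 0) := by
  classical
  ext u t
  have hL : (esel n lev r c * unfN lev r N) u t =
      ∑ s : St lev r, if s.1 = u ∧ (s.2 : ℕ) = c then unfN lev r N s t else 0 := by
    rw [Matrix.mul_apply]
    refine Finset.sum_congr rfl fun s _ => ?_
    simp only [esel]; split_ifs <;> simp
  have hD : (dgPart lev N * esel n lev r (c + 1)) u t = if (t.2 : ℕ) = c + 1 then dgPart lev N u t.1 else 0 := by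
    rw [Matrix.mul_apply, ← sum_fin_ite t.1 ((t.2 : ℕ) = c + 1) (fun w => dgPart lev N u w)]
    refine Finset.sum_congr rfl fun w _ => ?_
    simp only [esel]; split_ifs <;> simp_all
  have hU : (upPart lev N * esel n lev r 0) u t = if (t.2 : ℕ) = 0 then upPart lev N u t.1 else 0 := by
    rw [Matrix.mul_apply, ← sum_fin_ite t.1 ((t.2 : ℕ) = 0) (fun w => upPart lev N u w)]
    refine Finset.sum_congr rfl fun w _ => ?_
    simp only [esel]; split_ifs <;> simp_all
  rw [hL, sum_St_ite, psel, Matrix.diagonal_mul, Matrix.add_apply, hD, hU]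
  by_cases h : c < r (lev u)
  · rw [dif_pos h, if_pos h, one_mul]
    simp only [unfN, dgPart, upPart]
    by_cases h0 : (t.2 : ℕ) = 0
    · by_cases hlt : lev u < lev t.1
      · simp [h0, hlt]
      · simp [h0, hlt]
    · by_cases h1 : (t.2 : ℕ) = c + 1
      · by_cases heq : lev u = lev t.1
        · simp [h1, heq]
        · have : ¬ (lev u < lev t.1 ∧ (t.2 : ℕ) = 0) := fun hh => h0 hh.2
          simp [h1, heq]
      · simp [h0, h1]
  · rw [dif_neg h, if_neg h, zero_mul]

/-- Helper `esel_mul_fsel` of the unfolding core (val-idea-9 turnkey; docstring added at filing). [folklore] -/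
theorem esel_mul_fsel (c : ℕ) : esel n lev r c * fsel n lev r = psel n lev r c := by
  classical
  ext u w
  have hL : (esel n lev r c * fsel n lev r) u w =
      ∑ s : St lev r, if s.1 = u ∧ (s.2 : ℕ) = c then fsel n lev r s w else 0 := by
    rw [Matrix.mul_apply]
    refine Finset.sum_congr rfl fun s _ => ?_
    simp only [esel]; split_ifs <;> simp
  rw [hL, sum_St_ite, psel, Matrix.diagonal_apply]
  by_cases h : c < r (lev u)
  · rw [dif_pos h]; simp only [fsel]
    by_cases huw : u = w
    · subst huw; simp [h]
    · simp [huw]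
  · rw [dif_neg h]
    by_cases huw : u = w
    · subst huw; simp [h]
    · simp [huw]

/-- Helper `unfM_eq` of the unfolding core (val-idea-9 turnkey; docstring added at filing). [folklore] -/
theorem unfM_eq (M : AffMat n m) : unfM lev r M = fsel n lev r * M * esel n lev r 0 := by
  classical
  ext t s
  have h1 : (fsel n lev r * M) t = fun w => M t.1 w := by
    funext w
    rw [Matrix.mul_apply]
    simp only [fsel]
    rw [show (∑ u : Fin m, (if t.1 = u then (1 : MvPolynomial (Fin n × Fin n) ℂ) else 0) * M u w) = ∑ u : Fin m, (if t.1 = u then M u w else 0) from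
      Finset.sum_congr rfl fun u _ => by split_ifs <;> simp]
    rw [Finset.sum_ite_eq]; simp
  rw [Matrix.mul_apply]
  simp only [h1, esel, unfM]
  rw [show (∑ w : Fin m, M t.1 w * (if s.1 = w ∧ (s.2 : ℕ) = 0 then (1 : MvPolynomial (Fin n × Fin n) ℂ) else 0)) =
      ∑ w : Fin m, (if s.1 = w ∧ (s.2 : ℕ) = 0 then M t.1 w else 0) from
    Finset.sum_congr rfl fun w _ => by split_ifs <;> simp]
  rw [sum_fin_ite]

/-- Helper `psel_comm_dgPart` of the unfolding core (val-idea-9 turnkey; docstring added at filing). [folklore] -/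
theorem psel_comm_dgPart (N : AffMat n m) (c : ℕ) :
    Commute (psel n lev r c) (dgPart lev N) := by
  classical
  unfold Commute SemiconjBy
  ext u w
  rw [psel, Matrix.diagonal_mul, Matrix.mul_diagonal]
  simp only [dgPart]
  by_cases h : lev u = lev w
  · simp [h]
  · simp [h]

/-- Helper `psel_mul_psel` of the unfolding core (val-idea-9 turnkey; docstring added at filing). [folklore] -/
theorem psel_mul_psel (c j : ℕ) : psel n lev r c * psel n lev r (c + j) = psel n lev r (c + j) := by
  classical
  rw [psel, psel, Matrix.diagonal_mul_diagonal]
  congr 1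
  funext u
  by_cases h : c + j < r (lev u)
  · have h' : c < r (lev u) := by omega
    simp [h, h']
  · simp [h]

/-- Helper `diagBlock_pow_ne_zero` of the unfolding core (val-idea-9 turnkey; docstring added at filing). [folklore] -/
theorem diagBlock_pow_ne_zero (N : AffMat n m) (u : Fin m) :
    ∀ (j : ℕ) (v : Fin m), (diagBlock N lev (lev u) ^ j) u v ≠ 0 → lev v = lev u := by
  classical
  intro j
  induction j with
  | zero =>
      intro v hv
      rw [pow_zero] at hv
      by_cases h : u = v
      · rw [h]
      · exact absurd (Matrix.one_apply_ne h) hv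
  | succ j _ =>
      intro v hv
      rw [pow_succ, Matrix.mul_apply] at hv
      obtain ⟨v', -, hv'⟩ := Finset.exists_ne_zero_of_sum_ne_zero hv
      have hB : diagBlock N lev (lev u) v' v ≠ 0 := fun h0 => hv' (by rw [h0, mul_zero])
      simp only [diagBlock] at hB
      by_contra hne
      exact hB (by simp [hne])

/-- Helper `dgPart_pow_apply` of the unfolding core (val-idea-9 turnkey; docstring added at filing). [folklore] -/
theorem dgPart_pow_apply (N : AffMat n m) (u : Fin m) :
    ∀ (j : ℕ) (w : Fin m), (dgPart lev N ^ j) u w = (diagBlock N lev (lev u) ^ j) u w := by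
  classical
  intro j
  induction j with
  | zero => intro w; simp
  | succ j ih =>
      intro w
      rw [pow_succ, pow_succ, Matrix.mul_apply, Matrix.mul_apply]
      refine Finset.sum_congr rfl fun v _ => ?_
      rw [ih v]
      by_cases h0 : (diagBlock N lev (lev u) ^ j) u v = 0
      · rw [h0, zero_mul, zero_mul]
      · have hv : lev v = lev u := diagBlock_pow_ne_zero N u j v h0
        congr 1
        simp only [dgPart, diagBlock, hv, true_and]
        by_cases hw : lev u = lev w
        · simp [hw]
        · have hw' : ¬ lev w = lev u := fun h => hw h.symm
          simp [hw, hw']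

/-- Helper `dgPart_pow_apply_eq_zero` of the unfolding core (val-idea-9 turnkey; docstring added at filing). [folklore] -/
theorem dgPart_pow_apply_eq_zero (N : AffMat n m) (hnil : ∀ l, diagBlock N lev l ^ r l = 0)
    (u w : Fin m) {j : ℕ} (hj : r (lev u) ≤ j) : (dgPart lev N ^ j) u w = 0 := by
  rw [dgPart_pow_apply, ← Nat.add_sub_of_le hj, pow_add, hnil, zero_mul, Matrix.zero_apply]

/-- Helper `psel_mul_dgPart_pow` of the unfolding core (val-idea-9 turnkey; docstring added at filing). [folklore] -/
theorem psel_mul_dgPart_pow (N : AffMat n m) (hnil : ∀ l, diagBlock N lev l ^ r l = 0) (j : ℕ) :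
    psel n lev r j * dgPart lev N ^ j = dgPart lev N ^ j := by
  classical
  ext u w
  rw [psel, Matrix.diagonal_mul]
  by_cases h : j < r (lev u)
  · simp [h]
  · rw [dgPart_pow_apply_eq_zero N hnil u w (not_lt.mp h)]; simp

/-- first-`U` expansion of `(D + U)^d` -/
theorem add_pow_expand (D U : AffMat n m) (d : ℕ) :
    (D + U) ^ d = D ^ d + ∑ j ∈ Finset.range d, D ^ j * U * (D + U) ^ (d - 1 - j) := by
  induction d with
  | zero => simp
  | succ d ih =>
      rw [pow_succ, ih, add_mul, Finset.sum_mul, Finset.sum_range_succ, mul_add, ← pow_succ]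
      have hlast : D ^ d * U * (D + U) ^ (d + 1 - 1 - d) = D ^ d * U := by
        rw [show d + 1 - 1 - d = 0 by omega, pow_zero, mul_one]
      rw [hlast]
      have hsum : ∑ j ∈ Finset.range d, D ^ j * U * (D + U) ^ (d - 1 - j) * (D + U) =
          ∑ j ∈ Finset.range d, D ^ j * U * (D + U) ^ (d + 1 - 1 - j) := by
        refine Finset.sum_congr rfl fun j hj => ?_
        rw [Finset.mem_range] at hj
        rw [mul_assoc, ← pow_succ, show d - 1 - j + 1 = d + 1 - 1 - j by omega]
      rw [hsum]
      abel

/-- the right-hand side of the unfolding invariant -/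
def rhs (N : AffMat n m) (d c : ℕ) : AffMat n m :=
  psel n lev r (c + d) * dgPart lev N ^ d +
    ∑ j ∈ Finset.range d, psel n lev r (c + j) * dgPart lev N ^ j * upPart lev N * N ^ (d - 1 - j)

/-- Helper `dgPart_add_upPart` of the unfolding core (val-idea-9 turnkey; docstring added at filing). [folklore] -/
theorem dgPart_add_upPart (N : AffMat n m) (hup : ∀ u w, lev w < lev u → N u w = 0) :
    dgPart lev N + upPart lev N = N := by
  ext u w
  simp only [Matrix.add_apply, dgPart, upPart]
  rcases lt_trichotomy (lev u) (lev w) with h | h | h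
  · simp [h, ne_of_lt h]
  · simp [h]
  · simp [ne_of_gt h, not_lt.mpr (le_of_lt h), hup u w h]

/-- Helper `rhs_zero` of the unfolding core (val-idea-9 turnkey; docstring added at filing). [folklore] -/
theorem rhs_zero (N : AffMat n m) (hup : ∀ u w, lev w < lev u → N u w = 0)
    (hnil : ∀ l, diagBlock N lev l ^ r l = 0) (d : ℕ) : rhs (lev := lev) (r := r) N d 0 = N ^ d := by
  rw [rhs, zero_add, psel_mul_dgPart_pow N hnil]
  have hs : ∑ j ∈ Finset.range d, psel n lev r (0 + j) * dgPart lev N ^ j * upPart lev N * N ^ (d - 1 - j) =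
      ∑ j ∈ Finset.range d, dgPart lev N ^ j * upPart lev N * (dgPart lev N + upPart lev N) ^ (d - 1 - j) := by
    refine Finset.sum_congr rfl fun j _ => ?_
    rw [zero_add, psel_mul_dgPart_pow N hnil, dgPart_add_upPart N hup]
  rw [hs, ← add_pow_expand, dgPart_add_upPart N hup]

/-- Helper `rhs_succ` of the unfolding core (val-idea-9 turnkey; docstring added at filing). [folklore] -/
theorem rhs_succ (N : AffMat n m) (d c : ℕ) :
    psel n lev r c * dgPart lev N * rhs (lev := lev) (r := r) N d (c + 1) + psel n lev r c * upPart lev N * N ^ d =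
      rhs (lev := lev) (r := r) N (d + 1) c := by
  set D := dgPart lev N with hD
  set U := upPart lev N with hU
  have hc : ∀ x, D * psel n lev r x = psel n lev r x * D := fun x => ((psel_comm_dgPart N x).eq).symm
  -- head term
  have h1 : psel n lev r c * D * (psel n lev r (c + 1 + d) * D ^ d) = psel n lev r (c + (d + 1)) * D ^ (d + 1) := by
    calc psel n lev r c * D * (psel n lev r (c + 1 + d) * D ^ d)
        = psel n lev r c * (D * psel n lev r (c + 1 + d)) * D ^ d := by simp only [← mul_assoc]
      _ = psel n lev r c * psel n lev r (c + (d + 1)) * (D * D ^ d) := by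
          rw [hc, show c + 1 + d = c + (d + 1) by omega]; simp only [← mul_assoc]
      _ = psel n lev r (c + (d + 1)) * D ^ (d + 1) := by rw [psel_mul_psel, ← pow_succ']
  -- sum terms
  have h2 : ∀ j ∈ Finset.range d, psel n lev r c * D * (psel n lev r (c + 1 + j) * D ^ j * U * N ^ (d - 1 - j)) =
      psel n lev r (c + (j + 1)) * D ^ (j + 1) * U * N ^ (d + 1 - 1 - (j + 1)) := by
    intro j hj
    rw [Finset.mem_range] at hj
    rw [show d + 1 - 1 - (j + 1) = d - 1 - j by omega, show c + 1 + j = c + (j + 1) by omega]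
    calc psel n lev r c * D * (psel n lev r (c + (j + 1)) * D ^ j * U * N ^ (d - 1 - j))
        = psel n lev r c * (D * psel n lev r (c + (j + 1))) * D ^ j * U * N ^ (d - 1 - j) := by
          simp only [← mul_assoc]
      _ = psel n lev r c * psel n lev r (c + (j + 1)) * (D * D ^ j) * U * N ^ (d - 1 - j) := by
          rw [hc]; simp only [← mul_assoc]
      _ = psel n lev r (c + (j + 1)) * D ^ (j + 1) * U * N ^ (d - 1 - j) := by rw [psel_mul_psel, ← pow_succ']
  have h3 : psel n lev r c * U * N ^ d = psel n lev r (c + 0) * D ^ 0 * U * N ^ (d + 1 - 1 - 0) := by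
    rw [add_zero, pow_zero, mul_one, show d + 1 - 1 - 0 = d by omega]
  rw [rhs, rhs, mul_add, Finset.mul_sum, Finset.sum_range_succ' _ d, Finset.sum_congr rfl h2, h1, h3]
  abel

/-- Helper `esel_pow_fsel` of the unfolding core (val-idea-9 turnkey; docstring added at filing). [folklore] -/
theorem esel_pow_fsel (N : AffMat n m) (hup : ∀ u w, lev w < lev u → N u w = 0)
    (hnil : ∀ l, diagBlock N lev l ^ r l = 0) :
    ∀ d c, esel n lev r c * unfN lev r N ^ d * fsel n lev r = rhs (lev := lev) (r := r) N d c := by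
  intro d
  induction d with
  | zero =>
      intro c
      rw [pow_zero, Matrix.mul_one, esel_mul_fsel, rhs, Finset.range_zero, Finset.sum_empty, add_zero, add_zero,
        pow_zero, Matrix.mul_one]
  | succ d ih =>
      intro c
      have hassoc : esel n lev r c * unfN lev r N ^ (d + 1) * fsel n lev r =
          (esel n lev r c * unfN lev r N) * (unfN lev r N ^ d * fsel n lev r) := by
        rw [pow_succ']; simp only [Matrix.mul_assoc]
      rw [hassoc, esel_mul_unfN, ← rhs_succ N d c]
      rw [Matrix.mul_add, Matrix.add_mul]
      congr 1
      · calc psel n lev r c * (dgPart lev N * esel n lev r (c + 1)) * (unfN lev r N ^ d * fsel n lev r)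
            = psel n lev r c * dgPart lev N * (esel n lev r (c + 1) * unfN lev r N ^ d * fsel n lev r) := by
              simp only [Matrix.mul_assoc]
          _ = psel n lev r c * dgPart lev N * rhs N d (c + 1) := by rw [ih (c + 1)]
      · calc psel n lev r c * (upPart lev N * esel n lev r 0) * (unfN lev r N ^ d * fsel n lev r)
            = psel n lev r c * upPart lev N * (esel n lev r 0 * unfN lev r N ^ d * fsel n lev r) := by
              simp only [Matrix.mul_assoc]
          _ = psel n lev r c * upPart lev N * N ^ d := by rw [ih 0, rhs_zero N hup hnil]

/-- **THE UNFOLDING IDENTITY.** -/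
theorem trace_unfN_pow_mul_unfM (N M : AffMat n m) (hup : ∀ u w, lev w < lev u → N u w = 0)
    (hnil : ∀ l, diagBlock N lev l ^ r l = 0) (d : ℕ) :
    (unfN lev r N ^ d * unfM lev r M).trace = (N ^ d * M).trace := by
  rw [unfM_eq]
  calc (unfN lev r N ^ d * (fsel n lev r * M * esel n lev r 0)).trace
      = ((unfN lev r N ^ d * fsel n lev r * M) * esel n lev r 0).trace := by simp only [Matrix.mul_assoc]
    _ = (esel n lev r 0 * (unfN lev r N ^ d * fsel n lev r * M)).trace := Matrix.trace_mul_comm _ _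
    _ = ((esel n lev r 0 * unfN lev r N ^ d * fsel n lev r) * M).trace := by simp only [Matrix.mul_assoc]
    _ = (N ^ d * M).trace := by rw [esel_pow_fsel N hup hnil d 0, rhs_zero N hup hnil]

end Unfold

end Summit.ValiantsHypothesis.ValiantsHypothesis.Cruxes.TwoDimCoefficients.DimTwoCases

end
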